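/-
Copyright (c) 2026 the pub-hodgecm-mathlib formalisation cell (harness21).  Prover seat hodgecm-mathlib-R90-C133-p03 (g2) (S5 hand lent to S8; S8 dealer R90-CS-plan (g3)
S8-R153 (i) ∕ S8-R162 (3), 2026-09-05), Track B ∕ K2-LIT, h413 = `stmt-HodgeConjecture-24833`, R90-TF section S8 «ContSpec-n½»: (3′) the `τ`-ISOTYPIC PAIR-SECTION SPACES of
`U_{L∕L⁺}(3)` for a `K`-type `τ` of ANY dimension (DEFS + LEMMAS, groundwork of (R)′'s `hDISC` = T-disc-2′, census `R90/S8/CENSUS-Tdisc2prime-hDISC.R90-C133-p02-g0.md`) and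
(2′) the general-`k` CONJUGATION TWINS of ★ p862921 §1 ∕ ★ p863205 §3–§4 (the level moves `K′ ↦ kK′k⁻¹`, `ω ↦ ω ∘ Ad(k⁻¹)`).
-/
import Summits.HodgeConjecture.HodgeConjecture.Theorems.R90S8ResGMidAtomArchStableU3   -- ★ p863205 (K2E1-p11 (g4)): `rightRegular_apply_mem_resGMidAtomGen`'s inputs (`midPoleLetter_apply_quotientSubgroup_mul`, `flatSectionU_rightTranslation`), ★ `resGMidAtomGen`∕`resGMidAtom`∕`resGMidAtom_def` (p862682), ★ `chiSectionSpacePair` + API (K2E1ChiSectionSpaceU3PairDefs), ★ `eisensteinSeriesU_rightTranslation` (p862921)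
import Literature.NumberTheory.Automorphic.UnitaryIsotypicProjection                   -- ★ `Representation.homRangeSum` (the `τ`-part `V(τ)`), `apply_mem_homRangeSum`, `apply_mem_homRangeSum_of_mem`, `map_homRangeSum_le`, `finiteDimensional_homRangeSum`
import Mathlib.RepresentationTheory.Subrepresentation                                   -- Mathlib `Subrepresentation`, `Subrepresentation.toRepresentation`
import HarnessLib

/-!
# S8 (3′) — `R90S8ChiSectionKTypeIsotypicU3`: THE `τ`-ISOTYPIC PAIR-SECTION SPACES `V(χ₁, χ₂; K′, ω)^τ` OF `U(J₃)` FOR A `K`-TYPE `τ` OF ANY DIMENSION, THEIR ALGEBRA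
# (constructor, `K`-stability, functoriality under `K`-equivariant maps, finiteness from finite `K`-multiplicity, the one-dimensional junction), AND THE (2′) CONJUGATION TWINS

Track B ∕ K2-LIT, crux h413 = `stmt-HodgeConjecture-24833`, route of record `HCCMUnconditional`; cell `hodgecm-mathlib`, R90-TF programme, section S8 «ContSpec-n½», (R)′'s letter `hDISC`
(«`resGMidBlock ξ μω` is `K`-admissible», the `hadm` binder of ★ p863180 `le_discreteSpectrum_of_admissible`).  DEFINITIONS FILE (`--kind definition --supports stmt-HodgeConjecture-24833
--as helper`): TWO `def`s + lemmas; no `instance`, no `notation`, no named-fact hypothesis, no `sorry`; default heartbeats.  CLOSES NO SOCKET; pays no letter by itself.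

WHY (census `CENSUS-Tdisc2prime-hDISC` (3), S8 dealer S8-R153 (i)).  The `hadm` currency is ALGEBRAIC — «for every irreducible finite-dimensional `K`-stable `E ≤ W`, the `E`-part
`Representation.homRangeSum (W|_K) E` is finite-dimensional» — and ★ `Representation.homRangeSum ρ τ := ⨆_{T ∈ Hom_K(τ,ρ)} range T` (Wallach's `V(γ)`, PROJECTOR-FREE: no Haar measure, no
character `χ_τ`) is in the tree with its API.  What the SECTION side lacked is the `K`-module structure on the pair-section space `V(χ₁, χ₂; K′, ω)` (★ `chiSectionSpacePair`, which carries
only a ONE-dimensional `K′`-law `ω`) and its `τ`-part for `dim τ > 1` (`K_∞ ≅ U(2) × U(1)` is non-abelian).  Since ★ `AdelicGroupData.rightTranslation 𝒢 : Representation ℂ 𝒢.Adelic (𝒢.Adelic → ℂ)`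
exists, for an abstract group `K` with `ιK : K →* 𝒢.Adelic` whose image commutes with `K′` (the `hcomm` of ★ `rightTranslation_mem_chiSectionSpacePair`; at `K := K_∞`, `K′ := ι_f(K_f)` it is
★ `commute_archToAdelic_finAdelicToAdelic`) the section space IS a `Subrepresentation ((rightTranslation 𝒢).comp ιK)` — no new action is invented — and `τ` is ANY `Representation ℂ K W`.
Generic quadratic datum `(F, E, c)`, rank `3`, in §1–§2; the CM print `U_{L∕L⁺}(3) = quasiSplit L⁺ L c 3` in §3 (the mid-atom twins).

* §1 D1 **`chiSectionPairSubrep χ₁ χ₂ K′ ω ιK hcomm`** (the `K`-module of pair sections) + `rfl` read-backs; D2 **`chiSectionSpacePairKType χ₁ χ₂ K′ ω ιK hcomm τ`** := the `τ`-part of D1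
  pushed into `𝒢.Adelic → ℂ`; L1 `…_le`, L2 `mem_…_iff`, L3 `range_le_…` ∕ `apply_mem_…` (CONSTRUCTOR: an equivariant family `T : W →ₗ (𝒢.Adelic → ℂ)` of sections of type `τ` lands in
  `V^τ`), L4 `rightTranslation_mem_…` (`K`-stability), L5 `map_…_le_homRangeSum` («`τ`-components go to `τ`-components» under ANY `K`-equivariant linear map — the residue-map ∕
  Eisenstein-map step of the ROAD), L6 `finiteDimensional_…` (finite `K`-multiplicity ⇒ finite-dimensional `τ`-part; the multiplicity bound `hFrob : FiniteDimensional ℂ Hom_K(τ, V)` is an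
  HONEST NAMED BINDER — print's Frobenius bound `dim Hom_{K_∞K_f}(τ, Ind) ≤ dim τ · #(B(𝔸_f)∖G(𝔸_f)∕K_f)` needs the Iwasawa decomposition `G(𝔸) = B(𝔸)·K_∞K_f`, not in the tree),
  L7 `mem_…_iff_of_oneDim` (JUNCTION with the one-dimensional `K`-type currency of record: for `τ` on `ℂ` the `τ`-part is the eigen-subspace `φ(g·ιK k) = τ(k)(1)·φ(g)`).
* §2 (2′, every `k : 𝒢.Adelic`, NO commuting hypothesis) L8 **`rightTranslation_mem_chiSectionSpacePair_conj`**: `r(k)φ ∈ V(χ₁, χ₂; kK′k⁻¹, ω ∘ Ad(k⁻¹))` — `(r(k)φ)(g·kk′k⁻¹) = φ(gkk′) =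
  ω(k′)·(r(k)φ)(g)`.
* §3 (2′ at the mid atom, CM) L9 **`rightRegular_apply_mem_resGMidAtomGen_conj`** (★ p863205 §3's proof with L8 for the level step: generators go to generators of the CONJUGATED level, for `k`
  preserving the Borel height), L10 **`rightRegular_apply_mem_resGMidAtom_conj`** ∕ `map_rightRegular_resGMidAtom_le_conj` (closure step, p863205 §4 pattern):
  `R(k)(resGMidAtom ξ μω K′ ω) ≤ resGMidAtom ξ μω (kK′k⁻¹) (ω ∘ Ad k⁻¹)` — so atoms at a level NORMALISED by `ι_∞(K_∞)` with `Ad`-invariant `ω` are `K_∞`-stable with no commuting hypothesis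
  (census (2) «S extension, not ★» — now ★-shaped).
NOT CLAIMED: any control of `resGMidBlock^τ` by the atoms' `τ`-parts (the L item of the census: archimedean density ∕ `(𝔤,K)`-invariance of closures); the discharge of `hFrob`.
HONEST LABEL: HC_CM is proved only modulo the 7 printed citations (2 remaining named inputs: hLiu418 = `stmt-HodgeConjecture-24832`, h413 = `stmt-HodgeConjecture-24833`) until rung 0
closes; T-disc-2′ stays L; REL ≠ ★ ≠ BUILT; definitions and stability letters pay no socket; count-neutral.

## References
* [WallachRRG1] N. R. Wallach, *Real Reductive Groups I* (1988), §1.4.7 (`V(γ)`), §3.3.1 (admissibility: `dim V(γ) < ∞`).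
* [MoeglinWaldspurger1995] C. Mœglin, J.-L. Waldspurger, *Spectral Decomposition and Eisenstein Series* (1995), I.2.17 (induced spaces, `K`-finiteness of sections), II.1.5, IV.1.11, V.3.13.
* [BorelJacquet1979] A. Borel, H. Jacquet, *Automorphic forms and automorphic representations*, Corvallis PSPM 33.1 (1979), §4.6 (`K`-types, admissibility).
* [Rogawski1990] J. D. Rogawski, *Automorphic Representations of Unitary Groups in Three Variables* (1990), §13.9 p. 229 (ii).
-/

set_option autoImplicit false
set_option linter.dupNamespace false  -- the mandated namespace `…HodgeConjecture.HodgeConjecture.R90.S8` (LEAD #1 L1) repeats the summit's segment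

noncomputable section

open MeasureTheory Measure Set Filter Topology NumberField ContRepresentation
open Literature.NumberTheory Literature.NumberTheory.Automorphic Literature.NumberTheory.Automorphic.UnitaryGroup Literature.NumberTheory.GaloisRepresentations AdelicGroupData
open Literature.NumberTheory.Automorphic.Arthur2013.Leaves.TECR Literature.NumberTheory.Rogawski1990
open Summit.HodgeConjecture.HodgeConjecture.Cruxes.H413.K2E1BorelEisensteinU
open Summit.HodgeConjecture.HodgeConjecture.Cruxes.H413.K2E1CharacterEisensteinU3PairDefs
open Summit.HodgeConjecture.HodgeConjecture.Cruxes.H413.K2E1ChiSectionSpaceU3PairDefs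
open scoped ENNReal NNReal

namespace Summit.HodgeConjecture.HodgeConjecture.R90.S8

/-! ## §1 The `K`-module of pair sections and its `τ`-part (generic quadratic datum `(F, E, c)`, rank `3`) -/

section KType

variable {F E : Type} [Field F] [NumberField F] [Field E] [NumberField E] [Algebra F E] {c : E ≃ₐ[F] E}
  {K : Type*} [Group K]

/-- **D1 — THE `K`-MODULE OF PAIR SECTIONS**: for an abstract group `K` mapped into `G(𝔸_F)` by `ιK` with `ιK(K)` commuting with the level group `K′` (`hcomm`), the pair-section space
`V(χ₁, χ₂; K′, ω)` (★ `chiSectionSpacePair`) is stable under right translation by `ιK(K)` — a `Subrepresentation` of ★ `(rightTranslation 𝒢) ∘ ιK` (`(k·φ)(g) = φ(g·ιK k)`); the print's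
`K`-module structure of `Ind_{B(𝔸)}^{G(𝔸)}(χ₁, χ₂)` at level `(K′, ω)` (`K := K_∞`, `K′ := ι_f(K_f)`: ★ `commute_archToAdelic_finAdelicToAdelic`).
[cite: MoeglinWaldspurger1995, I.2.17] [cite: BorelJacquet1979, §4.6] -/
def chiSectionPairSubrep (χ₁ : HeckeCharacter E) (χ₂ : ↥(TorusDict.torus c) →ₜ* ℂˣ) (K' : Subgroup (quasiSplit F E c 3).Adelic) (ω : ↥K' → ℂ)
    (ιK : K →* (quasiSplit F E c 3).Adelic) (hcomm : ∀ k : K, ∀ k' ∈ K', k' * ιK k = ιK k * k') :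
    Subrepresentation ((rightTranslation (quasiSplit F E c 3)).comp ιK) where
  toSubmodule := chiSectionSpacePair χ₁ χ₂ K' ω
  apply_mem_toSubmodule k φ hφ := by
    rw [MonoidHom.comp_apply]
    refine ⟨fun b hb g => ?_, fun g k' => ?_⟩
    · rw [rightTranslation_apply, rightTranslation_apply, mul_assoc b g (ιK k)]
      exact isChiSectionPair_of_mem hφ b hb (g * ιK k)
    · rw [rightTranslation_apply, rightTranslation_apply, mul_assoc, hcomm k _ k'.2, ← mul_assoc]
      exact apply_mul_of_mem hφ (g * ιK k) k'

variable {χ₁ : HeckeCharacter E} {χ₂ : ↥(TorusDict.torus c) →ₜ* ℂˣ} {K' : Subgroup (quasiSplit F E c 3).Adelic} {ω : ↥K' → ℂ}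
  {ιK : K →* (quasiSplit F E c 3).Adelic} {hcomm : ∀ k : K, ∀ k' ∈ K', k' * ιK k = ιK k * k'}

/-- Read-back: the underlying submodule of D1 IS `V(χ₁, χ₂; K′, ω)` (`rfl`). [cite: MoeglinWaldspurger1995, I.2.17] -/
theorem chiSectionPairSubrep_toSubmodule :
    (chiSectionPairSubrep χ₁ χ₂ K' ω ιK hcomm).toSubmodule = chiSectionSpacePair χ₁ χ₂ K' ω := rfl

/-- Read-back: D1 acts by right translation through `ιK` (`rfl`): `(k·v)(g) = v(g·ιK k)`. [cite: MoeglinWaldspurger1995, I.2.17] -/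
theorem coe_chiSectionPairSubrep_apply (k : K) (v : ↥(chiSectionPairSubrep χ₁ χ₂ K' ω ιK hcomm).toSubmodule) :
    (((chiSectionPairSubrep χ₁ χ₂ K' ω ιK hcomm).toRepresentation k v : ↥(chiSectionPairSubrep χ₁ χ₂ K' ω ιK hcomm).toSubmodule) : (quasiSplit F E c 3).Adelic → ℂ) =
      rightTranslation (quasiSplit F E c 3) (ιK k) (v : (quasiSplit F E c 3).Adelic → ℂ) := rfl

variable (χ₁ χ₂ K' ω ιK hcomm) in
/-- **D2 — THE `τ`-ISOTYPIC PAIR-SECTION SPACE `V(χ₁, χ₂; K′, ω)^τ`** for a representation `τ` of `K` on `W` (a `K_∞`-type of any dimension): the `τ`-part of the `K`-module D1 — the sum of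
the images of ALL `K`-equivariant linear maps `τ → V(χ₁, χ₂; K′, ω)` (★ `Representation.homRangeSum`, Wallach's `V(γ)`; for irreducible `τ` the `τ`-isotypic subspace) — as a submodule of
`G(𝔸_F) → ℂ`.  Projector-free (no Haar measure, no character of `τ`). [cite: WallachRRG1, §1.4.7] [cite: MoeglinWaldspurger1995, I.2.17] [cite: BorelJacquet1979, §4.6] -/
def chiSectionSpacePairKType {W : Type*} [AddCommGroup W] [Module ℂ W] (τ : Representation ℂ K W) : Submodule ℂ ((quasiSplit F E c 3).Adelic → ℂ) :=
  (Representation.homRangeSum (chiSectionPairSubrep χ₁ χ₂ K' ω ιK hcomm).toRepresentation τ).map (chiSectionPairSubrep χ₁ χ₂ K' ω ιK hcomm).toSubmodule.subtype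

variable {W : Type*} [AddCommGroup W] [Module ℂ W] {τ : Representation ℂ K W}

/-- L1: `V^τ ≤ V` — `τ`-isotypic sections are sections. [cite: WallachRRG1, §1.4.7] -/
theorem chiSectionSpacePairKType_le : chiSectionSpacePairKType χ₁ χ₂ K' ω ιK hcomm τ ≤ chiSectionSpacePair χ₁ χ₂ K' ω := by
  rintro _ ⟨v, -, rfl⟩
  exact v.2

/-- L2: membership read-back — `φ ∈ V^τ` iff `φ ∈ V` and, as a vector of the `K`-module D1, `φ` lies in the `τ`-part. [cite: WallachRRG1, §1.4.7] -/
theorem mem_chiSectionSpacePairKType_iff (φ : (quasiSplit F E c 3).Adelic → ℂ) :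
    φ ∈ chiSectionSpacePairKType χ₁ χ₂ K' ω ιK hcomm τ ↔
      ∃ hφ : φ ∈ chiSectionSpacePair χ₁ χ₂ K' ω,
        (⟨φ, hφ⟩ : ↥(chiSectionPairSubrep χ₁ χ₂ K' ω ιK hcomm).toSubmodule) ∈
          Representation.homRangeSum (chiSectionPairSubrep χ₁ χ₂ K' ω ιK hcomm).toRepresentation τ := by
  constructor
  · rintro ⟨v, hv, rfl⟩
    exact ⟨v.2, hv⟩
  · rintro ⟨hφ, h⟩
    exact ⟨⟨φ, hφ⟩, h, rfl⟩

/-- **L3 — THE CONSTRUCTOR**: a linear family `T : W →ₗ (G(𝔸_F) → ℂ)` of SECTIONS (`T w ∈ V`) that is `K`-EQUIVARIANT for `τ` (`T(τ(k)w) = r(ιK k)(T w)`) has its range inside `V^τ` — this is how a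
payer exhibits `τ`-isotypic sections (e.g. matrix-coefficient sections of type `τ`). [cite: WallachRRG1, §1.4.7] [cite: MoeglinWaldspurger1995, I.2.17] -/
theorem range_le_chiSectionSpacePairKType (T : W →ₗ[ℂ] ((quasiSplit F E c 3).Adelic → ℂ)) (hTV : ∀ w, T w ∈ chiSectionSpacePair χ₁ χ₂ K' ω)
    (hT : ∀ (k : K) (w : W), T (τ k w) = rightTranslation (quasiSplit F E c 3) (ιK k) (T w)) :
    LinearMap.range T ≤ chiSectionSpacePairKType χ₁ χ₂ K' ω ιK hcomm τ := by
  -- `T`, corestricted to `V`, is a `K`-map `τ → V`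
  let T' : τ.IntertwiningMap (chiSectionPairSubrep χ₁ χ₂ K' ω ιK hcomm).toRepresentation :=
    { toLinearMap := LinearMap.codRestrict (chiSectionPairSubrep χ₁ χ₂ K' ω ιK hcomm).toSubmodule T hTV
      isIntertwining' := fun k => LinearMap.ext fun w => Subtype.ext (hT k w) }
  rintro _ ⟨w, rfl⟩
  exact ⟨⟨T w, hTV w⟩, Representation.apply_mem_homRangeSum T' w, rfl⟩

/-- L3, pointwise: each member `T w` of an equivariant family of sections of type `τ` lies in `V^τ`. [cite: WallachRRG1, §1.4.7] -/
theorem apply_mem_chiSectionSpacePairKType (T : W →ₗ[ℂ] ((quasiSplit F E c 3).Adelic → ℂ)) (hTV : ∀ w, T w ∈ chiSectionSpacePair χ₁ χ₂ K' ω)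
    (hT : ∀ (k : K) (w : W), T (τ k w) = rightTranslation (quasiSplit F E c 3) (ιK k) (T w)) (w : W) :
    T w ∈ chiSectionSpacePairKType χ₁ χ₂ K' ω ιK hcomm τ :=
  range_le_chiSectionSpacePairKType T hTV hT ⟨w, rfl⟩

/-- **L4 — `K`-STABILITY**: `V^τ` is stable under right translation by `ιK(K)` (★ `Representation.apply_mem_homRangeSum_of_mem`). [cite: WallachRRG1, §1.4.7] -/
theorem rightTranslation_mem_chiSectionSpacePairKType (k : K) {φ : (quasiSplit F E c 3).Adelic → ℂ} (hφ : φ ∈ chiSectionSpacePairKType χ₁ χ₂ K' ω ιK hcomm τ) :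
    rightTranslation (quasiSplit F E c 3) (ιK k) φ ∈ chiSectionSpacePairKType χ₁ χ₂ K' ω ιK hcomm τ := by
  obtain ⟨v, hv, rfl⟩ := hφ
  exact ⟨(chiSectionPairSubrep χ₁ χ₂ K' ω ιK hcomm).toRepresentation k v, Representation.apply_mem_homRangeSum_of_mem k hv, rfl⟩

/-- **L5 — FUNCTORIALITY («`τ`-components go to `τ`-components»)**: a linear map `S` out of `G(𝔸_F) → ℂ` into ANY `K`-module `(V′, ρ′)` that is `K`-equivariant ON SECTIONS
(`S(r(ιK k)φ) = ρ′(k)(S φ)` for `φ ∈ V`) maps `V^τ` into the `τ`-part of `ρ′` (★ `Representation.map_homRangeSum_le`) — the shape of the residue-map and of the Eisenstein-map steps of the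
`hDISC` road. [cite: WallachRRG1, §1.4.7] [cite: MoeglinWaldspurger1995, V.3.13] -/
theorem map_chiSectionSpacePairKType_le_homRangeSum {V' : Type*} [AddCommGroup V'] [Module ℂ V'] {ρ' : Representation ℂ K V'}
    (S : ((quasiSplit F E c 3).Adelic → ℂ) →ₗ[ℂ] V')
    (hS : ∀ (k : K), ∀ φ ∈ chiSectionSpacePair χ₁ χ₂ K' ω, S (rightTranslation (quasiSplit F E c 3) (ιK k) φ) = ρ' k (S φ)) :
    (chiSectionSpacePairKType χ₁ χ₂ K' ω ιK hcomm τ).map S ≤ Representation.homRangeSum ρ' τ := by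
  -- `S ∘ (V ↪ functions)` is a `K`-map `V → ρ′`
  let S' : (chiSectionPairSubrep χ₁ χ₂ K' ω ιK hcomm).toRepresentation.IntertwiningMap ρ' :=
    { toLinearMap := S ∘ₗ (chiSectionPairSubrep χ₁ χ₂ K' ω ιK hcomm).toSubmodule.subtype
      isIntertwining' := fun k => LinearMap.ext fun v => hS k v v.2 }
  rintro _ ⟨φ, ⟨v, hv, rfl⟩, rfl⟩
  exact Representation.map_homRangeSum_le S' ⟨v, hv, rfl⟩

/-- **L6 — FINITE `K`-MULTIPLICITY GIVES A FINITE-DIMENSIONAL `τ`-PART** (★ `Representation.finiteDimensional_homRangeSum`): if `τ` is finite-dimensional and `Hom_K(τ, V(χ₁, χ₂; K′, ω))` is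
finite-dimensional (`hFrob` — the Frobenius-reciprocity multiplicity bound of print, `≤ dim τ · #(B(𝔸_f)∖G(𝔸_f)∕K_f)` for `K = K_∞K_f` via the Iwasawa decomposition; an HONEST NAMED BINDER here,
not discharged), then `V^τ` is finite-dimensional. [cite: WallachRRG1, §3.3.1] [cite: MoeglinWaldspurger1995, I.2.17] [cite: BorelJacquet1979, §4.6] -/
theorem finiteDimensional_chiSectionSpacePairKType [FiniteDimensional ℂ W]
    (hFrob : FiniteDimensional ℂ (τ.IntertwiningMap (chiSectionPairSubrep χ₁ χ₂ K' ω ιK hcomm).toRepresentation)) :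
    FiniteDimensional ℂ ↥(chiSectionSpacePairKType χ₁ χ₂ K' ω ιK hcomm τ) := by
  haveI := hFrob
  haveI : FiniteDimensional ℂ ↥(Representation.homRangeSum (chiSectionPairSubrep χ₁ χ₂ K' ω ιK hcomm).toRepresentation τ) :=
    Representation.finiteDimensional_homRangeSum
  unfold chiSectionSpacePairKType
  infer_instance

/-- **L7 — THE ONE-DIMENSIONAL JUNCTION**: for a `K`-type `τ` on `ℂ` (a character: `τ(k) z = τ(k)(1)·z`), `φ ∈ V^τ` iff `φ` is a section with the EIGEN-LAW `φ(g·ιK k) = τ(k)(1)·φ(g)` — the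
one-dimensional `K_∞`-type currency of record (`ω`-eigensections) is the `dim τ = 1` case of D2. [cite: WallachRRG1, §1.4.7] [cite: MoeglinWaldspurger1995, I.2.17] -/
theorem mem_chiSectionSpacePairKType_iff_of_oneDim (τ : Representation ℂ K ℂ) (φ : (quasiSplit F E c 3).Adelic → ℂ) :
    φ ∈ chiSectionSpacePairKType χ₁ χ₂ K' ω ιK hcomm τ ↔
      φ ∈ chiSectionSpacePair χ₁ χ₂ K' ω ∧ ∀ (k : K) (g : (quasiSplit F E c 3).Adelic), φ (g * ιK k) = τ k 1 * φ g := by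
  -- a character acts by the scalar `τ k 1`
  have hτ : ∀ (k : K) (z : ℂ), τ k z = τ k 1 • z := fun k z => by
    rw [smul_eq_mul, mul_comm, ← smul_eq_mul, ← LinearMap.map_smul, smul_eq_mul, mul_one]
  constructor
  · rintro ⟨v, hv, rfl⟩
    refine ⟨v.2, ?_⟩
    simp only [Submodule.coe_subtype]
    -- the eigen-law holds on every `range T`, `T ∈ Hom_K(τ, V)`, and is additive
    unfold Representation.homRangeSum at hv
    induction hv using Submodule.iSup_induction' with
    | mem T v hv =>
      obtain ⟨z, rfl⟩ := hv
      intro k g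
      -- `T (τ k z) = k · (T z)`, i.e. `τ k 1 • T z = k · T z`; read at `g`
      have h := LinearMap.congr_fun (T.isIntertwining' k) z
      simp only [LinearMap.coe_comp, Function.comp_apply] at h
      rw [hτ k z, LinearMap.map_smul] at h
      have hg := congrFun (congrArg Subtype.val h) g
      rw [Submodule.coe_smul, Pi.smul_apply, smul_eq_mul, coe_chiSectionPairSubrep_apply, rightTranslation_apply] at hg
      exact hg.symm
    | zero =>
      intro k g
      simp only [ZeroMemClass.coe_zero, Pi.zero_apply, mul_zero]
    | add u u' _ _ hu hu' =>
      intro k g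
      simp only [Submodule.coe_add, Pi.add_apply, hu k g, hu' k g, mul_add]
  · rintro ⟨hφ, heig⟩
    -- `z ↦ z • φ` is a `K`-map `τ → V`
    have hT : ∀ k : K,
        (LinearMap.toSpanSingleton ℂ ↥(chiSectionPairSubrep χ₁ χ₂ K' ω ιK hcomm).toSubmodule ⟨φ, hφ⟩) ∘ₗ τ k =
          (chiSectionPairSubrep χ₁ χ₂ K' ω ιK hcomm).toRepresentation k ∘ₗ
            (LinearMap.toSpanSingleton ℂ ↥(chiSectionPairSubrep χ₁ χ₂ K' ω ιK hcomm).toSubmodule ⟨φ, hφ⟩) := by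
      intro k
      refine LinearMap.ext fun z => Subtype.ext (funext fun g => ?_)
      simp only [LinearMap.coe_comp, Function.comp_apply, LinearMap.toSpanSingleton_apply, Submodule.coe_smul, Pi.smul_apply, smul_eq_mul,
        coe_chiSectionPairSubrep_apply, rightTranslation_apply, heig k g, hτ k z]
      ring
    let T : τ.IntertwiningMap (chiSectionPairSubrep χ₁ χ₂ K' ω ιK hcomm).toRepresentation :=
      { toLinearMap := LinearMap.toSpanSingleton ℂ ↥(chiSectionPairSubrep χ₁ χ₂ K' ω ιK hcomm).toSubmodule ⟨φ, hφ⟩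
        isIntertwining' := hT }
    refine ⟨⟨φ, hφ⟩, ?_, rfl⟩
    have hmem := Representation.apply_mem_homRangeSum T (1 : ℂ)
    have h1 : T (1 : ℂ) = ⟨φ, hφ⟩ := by
      show (1 : ℂ) • (⟨φ, hφ⟩ : ↥(chiSectionPairSubrep χ₁ χ₂ K' ω ιK hcomm).toSubmodule) = ⟨φ, hφ⟩
      exact one_smul ℂ _
    rw [h1] at hmem
    exact hmem

end KType

/-! ## §2 (2′) The conjugation twin of ★ `rightTranslation_mem_chiSectionSpacePair`: EVERY `k`, the level moves `K′ ↦ kK′k⁻¹`, `ω ↦ ω ∘ Ad(k⁻¹)` -/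

section Conj

variable {F E : Type} [Field F] [NumberField F] [Field E] [NumberField E] [Algebra F E] {c : E ≃ₐ[F] E}
  {χ₁ : HeckeCharacter E} {χ₂ : ↥(TorusDict.torus c) →ₜ* ℂˣ} {K' : Subgroup (quasiSplit F E c 3).Adelic} {ω : ↥K' → ℂ}

/-- Read-back of the conjugated level: `x ∈ K′.comap (Ad k⁻¹) ↔ k⁻¹ x k ∈ K′`, i.e. `K′.comap ((MulAut.conj k).symm) = k K′ k⁻¹`. [cite: BorelJacquet1979, §4.6] -/
theorem mem_comap_conj_symm_iff {G : Type*} [Group G] (H : Subgroup G) (k x : G) :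
    x ∈ H.comap ((MulAut.conj k).symm.toMonoidHom : G →* G) ↔ k⁻¹ * x * k ∈ H := by
  rw [Subgroup.mem_comap, MulEquiv.coe_toMonoidHom, MulAut.conj_symm_apply]

/-- **L8 — RIGHT TRANSLATION BY ANY `k` MOVES THE LEVEL BY CONJUGATION**: if `φ ∈ V(χ₁, χ₂; K′, ω)` then `r(k)φ ∈ V(χ₁, χ₂; kK′k⁻¹, ω ∘ Ad(k⁻¹))` — the left `B(𝔸)`-law is untouched
(`(r(k)φ)(bg) = φ(bgk)`), and for `x ∈ kK′k⁻¹`: `(r(k)φ)(g·x) = φ(g k · k⁻¹xk) = ω(k⁻¹xk)·φ(gk) = ω(Ad(k⁻¹)x)·(r(k)φ)(g)`.  No commuting hypothesis (the general-`k` twin of ★ p862921 §1,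
census (2)).  The conjugated level `kK′k⁻¹` is spelled `K'.comap (MulAut.conj k).symm` (= `{x | k⁻¹xk ∈ K′}`, `mem_comap_conj_symm_iff`) and `Ad(k⁻¹)` on it is Mathlib's
`MonoidHom.subgroupComap`. [cite: MoeglinWaldspurger1995, I.2.17, II.1.5] [cite: BorelJacquet1979, §4.6] -/
theorem rightTranslation_mem_chiSectionSpacePair_conj (k : (quasiSplit F E c 3).Adelic) {φ : (quasiSplit F E c 3).Adelic → ℂ} (hφ : φ ∈ chiSectionSpacePair χ₁ χ₂ K' ω) :
    rightTranslation (quasiSplit F E c 3) k φ ∈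
      chiSectionSpacePair χ₁ χ₂ (K'.comap ((MulAut.conj k).symm.toMonoidHom : (quasiSplit F E c 3).Adelic →* (quasiSplit F E c 3).Adelic))
        (fun x => ω (MonoidHom.subgroupComap ((MulAut.conj k).symm.toMonoidHom : (quasiSplit F E c 3).Adelic →* (quasiSplit F E c 3).Adelic) K' x)) := by
  refine ⟨fun b hb g => ?_, fun g x => ?_⟩
  · rw [rightTranslation_apply, rightTranslation_apply, mul_assoc b g k]
    exact isChiSectionPair_of_mem hφ b hb (g * k)
  · -- `Ad(k⁻¹) x = k⁻¹ x k ∈ K′`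
    have hval : ((MonoidHom.subgroupComap ((MulAut.conj k).symm.toMonoidHom : (quasiSplit F E c 3).Adelic →* (quasiSplit F E c 3).Adelic) K' x : ↥K') :
        (quasiSplit F E c 3).Adelic) = k⁻¹ * (x : (quasiSplit F E c 3).Adelic) * k := by
      show (MulAut.conj k).symm (x : (quasiSplit F E c 3).Adelic) = _
      rw [MulAut.conj_symm_apply]
    have hgx : g * (x : (quasiSplit F E c 3).Adelic) * k =
        g * k * ((MonoidHom.subgroupComap ((MulAut.conj k).symm.toMonoidHom : (quasiSplit F E c 3).Adelic →* (quasiSplit F E c 3).Adelic) K' x : ↥K') :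
          (quasiSplit F E c 3).Adelic) := by
      rw [hval]
      group
    rw [rightTranslation_apply, rightTranslation_apply, hgx]
    exact apply_mul_of_mem hφ (g * k) _

end Conj

/-! ## §3 (2′ at the print) The middle-pole residue atom under `R(k)` for a height-preserving `k` NOT commuting with the level: the level is conjugated -/

section ConjCM

variable (L : Type) [Field L] [NumberField L] [IsCMField L]
  (μ : Measure (quasiSplit (↥(maximalRealSubfield L)) L (IsCMField.complexConj L) 3).automorphicQuotient) [(quasiSplit (↥(maximalRealSubfield L)) L (IsCMField.complexConj L) 3).IsAutomorphicMeasure μ]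
  (ξ : OneDimAutRepH L) (μω : HeckeCharacter L)
  (K' : Subgroup (quasiSplit (↥(maximalRealSubfield L)) L (IsCMField.complexConj L) 3).Adelic) (ω : ↥K' →* ℂ)

/-- **L9 — GENERATORS GO TO GENERATORS OF THE CONJUGATED LEVEL**: for `k ∈ G(𝔸)` preserving the Borel height (`hHk`; e.g. `k ∈ ι_∞(K_∞)`), with NO commuting hypothesis, `R(k)` maps a generator
of the middle-pole residue atom of `ξ` at level `(K′, ω)` (★ `resGMidAtomGen`, data `(φ, Ec, Sp, Fp)`) to the generator at the CONJUGATED level `(kK′k⁻¹, ω ∘ Ad(k⁻¹))` with data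
`(r(k)φ, Ec(·)(· k), Sp, Fp(· k))` — ★ p863205 §3's argument verbatim (translated family ★ `flatSectionU_rightTranslation` + ★ `eisensteinSeriesU_rightTranslation`; the a.e. class of `R(k) f` by ★
`rightRegular_apply_coeFn` + ★ `quotFun_rightTranslation`, fed by the left-`G(F)`-invariance of the residue function ★ `midPoleLetter_apply_quotientSubgroup_mul`), with §2 L8 for the level
step. [cite: MoeglinWaldspurger1995, II.1.1, II.1.5, IV.1.11] [cite: BorelJacquet1979, §4.6] -/
theorem rightRegular_apply_mem_resGMidAtomGen_conj {k : (quasiSplit (↥(maximalRealSubfield L)) L (IsCMField.complexConj L) 3).Adelic}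
    (hHk : ∀ g : (quasiSplit (↥(maximalRealSubfield L)) L (IsCMField.complexConj L) 3).Adelic, borelHeight (g * k) = borelHeight g)
    {f : (quasiSplit (↥(maximalRealSubfield L)) L (IsCMField.complexConj L) 3).L2 μ} (hf : f ∈ resGMidAtomGen L μ ξ μω K' ω) :
    ((quasiSplit (↥(maximalRealSubfield L)) L (IsCMField.complexConj L) 3).rightRegular μ) k f ∈
      resGMidAtomGen L μ ξ μω
        (K'.comap ((MulAut.conj k).symm.toMonoidHom : (quasiSplit (↥(maximalRealSubfield L)) L (IsCMField.complexConj L) 3).Adelic →* (quasiSplit (↥(maximalRealSubfield L)) L (IsCMField.complexConj L) 3).Adelic))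
        (ω.comp (MonoidHom.subgroupComap ((MulAut.conj k).symm.toMonoidHom : (quasiSplit (↥(maximalRealSubfield L)) L (IsCMField.complexConj L) 3).Adelic →* (quasiSplit (↥(maximalRealSubfield L)) L (IsCMField.complexConj L) 3).Adelic) K')) := by
  obtain ⟨φ, hφ, hφc, Ec, Sp, hSp, hol, hEc, Fp, hF, hFE, hae⟩ := hf
  -- the translated section is continuous
  have hck : Continuous (rightTranslation (quasiSplit (↥(maximalRealSubfield L)) L (IsCMField.complexConj L) 3) k φ) := by
    have h : rightTranslation (quasiSplit (↥(maximalRealSubfield L)) L (IsCMField.complexConj L) 3) k φ = fun g => φ (g * k) := funext fun g => rfl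
    rw [h]
    exact hφc.comp (continuous_id.mul continuous_const)
  -- THE CONTENT (★ p863205 §2): the residue function `g ↦ Fp g (3/2)` is left-`G(F)`-invariant
  have hinv : ∀ γ ∈ (quasiSplit (↥(maximalRealSubfield L)) L (IsCMField.complexConj L) 3).quotientSubgroup, ∀ g : (quasiSplit (↥(maximalRealSubfield L)) L (IsCMField.complexConj L) 3).Adelic,
      (fun g : (quasiSplit (↥(maximalRealSubfield L)) L (IsCMField.complexConj L) 3).Adelic => Fp g ((3 : ℂ) / 2)) (γ * g) =
        (fun g : (quasiSplit (↥(maximalRealSubfield L)) L (IsCMField.complexConj L) 3).Adelic => Fp g ((3 : ℂ) / 2)) g :=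
    midPoleLetter_apply_quotientSubgroup_mul L (isChiSectionPair_of_mem hφ) ξ.hψ (fun s hs => (hSp s hs).1) hol hEc (by norm_num) (by norm_num) hF hFE
  -- right translation on `G(𝔸)` = the left action on the quotient, for the invariant residue function
  have h3 := AdelicGroupData.quotFun_rightTranslation (φ := fun g : (quasiSplit (↥(maximalRealSubfield L)) L (IsCMField.complexConj L) 3).Adelic => Fp g ((3 : ℂ) / 2)) hinv k
  refine ⟨rightTranslation (quasiSplit (↥(maximalRealSubfield L)) L (IsCMField.complexConj L) 3) k φ, rightTranslation_mem_chiSectionSpacePair_conj k hφ, hck,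
    fun z g => Ec z (g * k), Sp, hSp, fun g => hol (g * k), fun z hz => ?_, fun g => Fp (g * k), fun g => hF (g * k), fun g => hFE (g * k), ?_⟩
  · -- the continuation clause of the translated family
    funext g
    show Ec z (g * k) = eisensteinSeriesU (flatSectionU (rightTranslation (quasiSplit (↥(maximalRealSubfield L)) L (IsCMField.complexConj L) 3) k φ) z) g
    rw [flatSectionU_rightTranslation L hHk, eisensteinSeriesU_rightTranslation, hEc z hz]
  · -- the a.e. class of `R(k) f`
    have h1 := (quasiSplit (↥(maximalRealSubfield L)) L (IsCMField.complexConj L) 3).rightRegular_apply_coeFn μ k f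
    have h2 := (measurePreserving_smul k⁻¹ μ).quasiMeasurePreserving.ae_eq_comp hae
    exact h1.trans (h2.trans (Filter.Eventually.of_forall fun x => (congrFun h3 x).symm))

/-- **L10 — THE CONJUGATED STABILITY LETTER OF THE MIDDLE-POLE RESIDUE ATOM** (pointwise form): for `k` preserving the Borel height, `R(k)` maps `resGMidAtom ξ μω K′ ω` (★ p862682: the CLOSED span
of the generators) into `resGMidAtom ξ μω (kK′k⁻¹) (ω ∘ Ad k⁻¹)` — generators to generators (L9), span by linearity, closure by continuity of `R(k)` (★ p863205 §4 pattern).  At `K′ ⊴`-normalised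
by `ι_∞(K_∞)` with `Ad`-invariant `ω` this is `K_∞`-stability of the atom with no commuting hypothesis. [cite: MoeglinWaldspurger1995, II.1.5, V.3.13] [cite: BorelJacquet1979, §4.6] -/
theorem rightRegular_apply_mem_resGMidAtom_conj {k : (quasiSplit (↥(maximalRealSubfield L)) L (IsCMField.complexConj L) 3).Adelic}
    (hHk : ∀ g : (quasiSplit (↥(maximalRealSubfield L)) L (IsCMField.complexConj L) 3).Adelic, borelHeight (g * k) = borelHeight g)
    {v : (quasiSplit (↥(maximalRealSubfield L)) L (IsCMField.complexConj L) 3).L2 μ} (hv : v ∈ resGMidAtom L μ ξ μω K' ω) :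
    ((quasiSplit (↥(maximalRealSubfield L)) L (IsCMField.complexConj L) 3).rightRegular μ) k v ∈
      resGMidAtom L μ ξ μω
        (K'.comap ((MulAut.conj k).symm.toMonoidHom : (quasiSplit (↥(maximalRealSubfield L)) L (IsCMField.complexConj L) 3).Adelic →* (quasiSplit (↥(maximalRealSubfield L)) L (IsCMField.complexConj L) 3).Adelic))
        (ω.comp (MonoidHom.subgroupComap ((MulAut.conj k).symm.toMonoidHom : (quasiSplit (↥(maximalRealSubfield L)) L (IsCMField.complexConj L) 3).Adelic →* (quasiSplit (↥(maximalRealSubfield L)) L (IsCMField.complexConj L) 3).Adelic) K')) := by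
  rw [resGMidAtom_def] at hv ⊢
  refine (Submodule.topologicalClosure_minimal _ (Submodule.span_le.2 ?_)
    ((Submodule.isClosed_topologicalClosure _).preimage (((quasiSplit (↥(maximalRealSubfield L)) L (IsCMField.complexConj L) 3).rightRegular μ) k).continuous) :
    (Submodule.span ℂ _).topologicalClosure ≤ ((Submodule.span ℂ _).topologicalClosure).comap
      ((((quasiSplit (↥(maximalRealSubfield L)) L (IsCMField.complexConj L) 3).rightRegular μ) k :
        (quasiSplit (↥(maximalRealSubfield L)) L (IsCMField.complexConj L) 3).L2 μ →L[ℂ] (quasiSplit (↥(maximalRealSubfield L)) L (IsCMField.complexConj L) 3).L2 μ) :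
        (quasiSplit (↥(maximalRealSubfield L)) L (IsCMField.complexConj L) 3).L2 μ →ₗ[ℂ] (quasiSplit (↥(maximalRealSubfield L)) L (IsCMField.complexConj L) 3).L2 μ)) hv
  intro f hf
  rw [SetLike.mem_coe, Submodule.mem_comap, ContinuousLinearMap.coe_coe]
  exact Submodule.le_topologicalClosure _ (Submodule.subset_span (rightRegular_apply_mem_resGMidAtomGen_conj L μ ξ μω K' ω hHk hf))

/-- L10, lattice form: `(resGMidAtom ξ μω K′ ω).map R(k) ≤ resGMidAtom ξ μω (kK′k⁻¹) (ω ∘ Ad k⁻¹)` for `k` preserving the Borel height. [cite: MoeglinWaldspurger1995, II.1.5, V.3.13] -/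
theorem map_rightRegular_resGMidAtom_le_conj {k : (quasiSplit (↥(maximalRealSubfield L)) L (IsCMField.complexConj L) 3).Adelic}
    (hHk : ∀ g : (quasiSplit (↥(maximalRealSubfield L)) L (IsCMField.complexConj L) 3).Adelic, borelHeight (g * k) = borelHeight g) :
    (resGMidAtom L μ ξ μω K' ω).map ((((quasiSplit (↥(maximalRealSubfield L)) L (IsCMField.complexConj L) 3).rightRegular μ) k :
      (quasiSplit (↥(maximalRealSubfield L)) L (IsCMField.complexConj L) 3).L2 μ →L[ℂ] (quasiSplit (↥(maximalRealSubfield L)) L (IsCMField.complexConj L) 3).L2 μ) :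
      (quasiSplit (↥(maximalRealSubfield L)) L (IsCMField.complexConj L) 3).L2 μ →ₗ[ℂ] (quasiSplit (↥(maximalRealSubfield L)) L (IsCMField.complexConj L) 3).L2 μ) ≤
      resGMidAtom L μ ξ μω
        (K'.comap ((MulAut.conj k).symm.toMonoidHom : (quasiSplit (↥(maximalRealSubfield L)) L (IsCMField.complexConj L) 3).Adelic →* (quasiSplit (↥(maximalRealSubfield L)) L (IsCMField.complexConj L) 3).Adelic))
        (ω.comp (MonoidHom.subgroupComap ((MulAut.conj k).symm.toMonoidHom : (quasiSplit (↥(maximalRealSubfield L)) L (IsCMField.complexConj L) 3).Adelic →* (quasiSplit (↥(maximalRealSubfield L)) L (IsCMField.complexConj L) 3).Adelic) K')) := by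
  rintro _ ⟨v, hv, rfl⟩
  exact rightRegular_apply_mem_resGMidAtom_conj L μ ξ μω K' ω hHk hv

end ConjCM

end Summit.HodgeConjecture.HodgeConjecture.R90.S8

end
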